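import Literature.NumberTheory.EllipticCurves.BinaryQuarticGeometricSieveProofs
import Literature.NumberTheory.EllipticCurves.BinaryQuarticResolventEmbedding
import Literature.NumberTheory.Sieve.DivisorBound
import Mathlib.RingTheory.Polynomial.RationalRoot
import Mathlib.Algebra.Polynomial.SpecificDegree
import HarnessLib

/-!
# Binary quartic forms whose resolvent cubic has a rational root are negligible in boxes:
# `#{f ∈ [−T,T]⁵ : a ≠ 0, g_f(r, 1) = 0 for some r ∈ ℤ} ≪_ε T^{4+ε}`

`Proofs` file (theorems only: no definitions, no named facts). Context: M. Bhargava, A. Shankar,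
*Binary quartic forms having bounded invariants, and the boundedness of the average rank of
elliptic curves*, Ann. of Math. (2) 181 (2015) 191–242, §2.6 of the published version, where the
uniformity estimate for the weakly divisible forms `W_p^{(2)}(V)` is imported from
[dodqf, Prop. 23] (M. Bhargava, Ann. of Math. 162 (2005), Prop. 23) through the map
`ψ : PGL₂(ℤ)\V_ℤ → (GL₂(ℤ) × SL₃(ℤ))\W_ℤ` (Thm 2.14, Prop. 2.16, Thm 2.19;
`BinaryQuarticResolventTransfer.lean`). The counting function `N(·; X)` of [dodqf] counts
*absolutely irreducible* orbits — pairs `(A, B)` whose conics have no common rational zero **and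
whose resolvent binary cubic form `Det(Ax − By)` is irreducible over `ℚ`** ([dodqf], §2.2,
p. 1037) — whereas `N(S; X)` of Bhargava–Shankar counts classes of all irreducible quartic forms
`f`, and the resolvent cubic `g_f = X³ + cX²Y + (bd − 4ae)XY² + (ad² + b²e − 4ace)Y³` of an
irreducible `f` may well be reducible (e.g. `f = x⁴ + 2y⁴`, `g_f = X(X² − 8Y²)`; this happens
exactly when the Jacobian `E_f` has a rational `2`-torsion point). This file supplies the estimate
showing that such forms are negligible in the boxes `[−T, T]⁵ ⊃ 𝓕^{(ε)}·R^{(i)}(X) ∩ V_ℤ`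
(`T ≍ X^{1/6}`) of the sieve of §2.6–2.7, so that either reading of Thm 2.19 can be fed into the
transport of `BinaryQuarticResolventTransfer`:

* `card_box_filter_exists_int_root_resolvent_le`: for every `ε > 0` there is `C` with
  `#{(a,b,c,d,e) ∈ [−T,T]⁵ : a ≠ 0, ∃ r ∈ ℤ, g(r,1) = 0} ≤ C·T^{4+ε}` for all `T ≥ 1`;
  `card_filter_exists_int_root_resolvent_le`: the same for any finite set of forms with
  coefficients bounded by `T`;
* `exists_int_root_resolvent_iff_not_irreducible`: for any integral `f`, `g_f(·, 1)` has an
  integer root iff the monic cubic `g_f(X, 1) ∈ ℚ[X]` is reducible (Gauss / rational root theorem).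

## The (elementary) argument

Write `g(r,1) = N(r) + e·m(r)` with `N(r) = r³ + cr² + bdr + ad²`, `m(r) = b² − 4a(r + c)`
(`resolvent_root_eq`). Fix `(a, b, c, d)` with `a ≠ 0` and let `r` be an integer root.
(i) If `m(r) = 0` then `r` is determined by `(a,b,c)` and `N(r) = 0` is a nonzero quadratic
equation for `d` (leading coefficient `a`): at most `2(2T+1)⁴` forms. (ii) Otherwise
`e = −N(r)/m(r)` is determined by `(a,b,c,d,r)`, and `m(r)` divides
`R(a,b,c,d) = (8a²d + b³ − 4abc)²`, because `64a³N(r) − R = −m(r)·Q` (`key_identity`; reduce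
`4ar ≡ b² − 4ac (mod m)`). If `R = 0` then `d` is determined by `(a,b,c)`: at most `(2T+1)⁴`
forms. If `R ≠ 0` then `r ↦ |m(r)|` is at most two-to-one into the divisors of `R ≤ 169T⁶`, so by
the divisor bound `τ(n) ≤ C_δ n^δ` (`Literature.NumberTheory.Sieve.exists_card_divisors_le_mul_rpow'`,
Hardy–Wright Thm 315) at most `2C_δ(169T⁶)^δ` values of `e` per quadruple.

## References

* M. Bhargava, A. Shankar, Ann. of Math. (2) 181 (2015) 191–242, §2.6 (Thm 2.19 and the estimate
  `N(W_p^{(2)}(V); X) = O(X/p²)`; published numbering). [cite: BhargavaShankarAnnals2015, §2.6 (Thm 2.19 = dodqf Prop. 23; published numbering)]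
* M. Bhargava, *The density of discriminants of quartic rings and fields*, Ann. of Math. (2) 162
  (2005) 1031–1063, §2.2 p. 1037 (absolutely irreducible pairs) and Prop. 23.
* G. H. Hardy, E. M. Wright, *An Introduction to the Theory of Numbers*, Thm 315 (the divisor
  bound), through `Literature/NumberTheory/Sieve/DivisorBound.lean`.
-/

noncomputable section

open scoped Classical
open Finset Polynomial

namespace Literature.NumberTheory.EllipticCurves

namespace BinaryQuartic

/-! ## §1 Algebra of an integer root of the resolvent cubic -/

/-- `g(r, 1) = N(r) + e·m(r)` with `N(r) = r³ + cr² + bdr + ad²`, `m(r) = b² − 4a(r + c)`: the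
resolvent cubic is affine-linear in `e`. [folklore] -/
theorem resolvent_root_eq (a b c d e r : ℤ) :
    r ^ 3 + c * r ^ 2 + (b * d - 4 * a * e) * r + (a * d ^ 2 + b ^ 2 * e - 4 * a * c * e)
      = (r ^ 3 + c * r ^ 2 + b * d * r + a * d ^ 2) + e * (b ^ 2 - 4 * a * (r + c)) := by
  ring

/-- **Key identity**: `64a³N(r) − (8a²d + b³ − 4abc)² = −m(r)·Q(a,b,c,d,r)`; hence `m(r) ∣ N(r)`
forces `m(r) ∣ (8a²d + b³ − 4abc)²`. [folklore] -/
theorem key_identity (a b c d r : ℤ) :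
    64 * a ^ 3 * (r ^ 3 + c * r ^ 2 + b * d * r + a * d ^ 2)
        - (8 * a ^ 2 * d + b ^ 3 - 4 * a * b * c) ^ 2
      = -(b ^ 2 - 4 * a * (r + c)) *
          ((4 * a * r) ^ 2 + (4 * a * r) * (b ^ 2 - 4 * a * c) + (b ^ 2 - 4 * a * c) ^ 2
            + 4 * a * c * (4 * a * r + (b ^ 2 - 4 * a * c)) + 16 * a ^ 2 * b * d) := by
  ring

/-- If `r` is a root with `m(r) ≠ 0`… more precisely: whenever `N(r) + e·m(r) = 0`, `m(r)` divides
`(8a²d + b³ − 4abc)²`. [folklore] -/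
theorem m_dvd_R_of_root {a b c d e r : ℤ}
    (h : (r ^ 3 + c * r ^ 2 + b * d * r + a * d ^ 2) + e * (b ^ 2 - 4 * a * (r + c)) = 0) :
    (b ^ 2 - 4 * a * (r + c)) ∣ (8 * a ^ 2 * d + b ^ 3 - 4 * a * b * c) ^ 2 := by
  have hN : (b ^ 2 - 4 * a * (r + c)) ∣ (r ^ 3 + c * r ^ 2 + b * d * r + a * d ^ 2) :=
    ⟨-e, by linarith⟩
  have h64 : (b ^ 2 - 4 * a * (r + c)) ∣
      64 * a ^ 3 * (r ^ 3 + c * r ^ 2 + b * d * r + a * d ^ 2) := hN.mul_left _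
  have hQ : (b ^ 2 - 4 * a * (r + c)) ∣
      64 * a ^ 3 * (r ^ 3 + c * r ^ 2 + b * d * r + a * d ^ 2)
        - (8 * a ^ 2 * d + b ^ 3 - 4 * a * b * c) ^ 2 := by
    rw [key_identity, neg_mul]; exact (dvd_mul_right _ _).neg_right
  have := (dvd_sub_right h64).mp hQ
  exact this

/-- The size of `R`: `|8a²d + b³ − 4abc| ≤ 13T³` for `|a|, |b|, |c|, |d| ≤ T`. [folklore] -/
theorem abs_Rbase_le {T : ℕ} {a b c d : ℤ} (ha : |a| ≤ T) (hb : |b| ≤ T) (hc : |c| ≤ T)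
    (hd : |d| ≤ T) : |8 * a ^ 2 * d + b ^ 3 - 4 * a * b * c| ≤ 13 * (T : ℤ) ^ 3 := by
  have hT : (0 : ℤ) ≤ T := Int.natCast_nonneg T
  have h1 : |8 * a ^ 2 * d| ≤ 8 * (T : ℤ) ^ 3 := by
    rw [abs_mul, abs_mul, abs_pow, abs_of_pos (by norm_num : (0 : ℤ) < 8)]
    calc 8 * |a| ^ 2 * |d| ≤ 8 * (T : ℤ) ^ 2 * T := by
          gcongr
      _ = 8 * (T : ℤ) ^ 3 := by ring
  have h2 : |b ^ 3| ≤ (T : ℤ) ^ 3 := by rw [abs_pow]; gcongr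
  have h3 : |4 * a * b * c| ≤ 4 * (T : ℤ) ^ 3 := by
    rw [abs_mul, abs_mul, abs_mul, abs_of_pos (by norm_num : (0 : ℤ) < 4)]
    calc 4 * |a| * |b| * |c| ≤ 4 * (T : ℤ) * T * T := by gcongr
      _ = 4 * (T : ℤ) ^ 3 := by ring
  calc |8 * a ^ 2 * d + b ^ 3 - 4 * a * b * c|
      ≤ |8 * a ^ 2 * d + b ^ 3| + |4 * a * b * c| := abs_sub _ _
    _ ≤ |8 * a ^ 2 * d| + |b ^ 3| + |4 * a * b * c| := by gcongr; exact abs_add_le _ _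
    _ ≤ 8 * (T : ℤ) ^ 3 + (T : ℤ) ^ 3 + 4 * (T : ℤ) ^ 3 := by gcongr
    _ = 13 * (T : ℤ) ^ 3 := by ring

/-- Hence `R = (8a²d + b³ − 4abc)² ≤ 169T⁶` (as a natural number). [folklore] -/
theorem natAbs_R_le {T : ℕ} {a b c d : ℤ} (ha : |a| ≤ T) (hb : |b| ≤ T) (hc : |c| ≤ T)
    (hd : |d| ≤ T) : ((8 * a ^ 2 * d + b ^ 3 - 4 * a * b * c) ^ 2).natAbs ≤ 169 * T ^ 6 := by
  have h := abs_Rbase_le ha hb hc hd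
  have h0 : (0 : ℤ) ≤ 13 * (T : ℤ) ^ 3 := by positivity
  have hsq : (8 * a ^ 2 * d + b ^ 3 - 4 * a * b * c) ^ 2 ≤ (13 * (T : ℤ) ^ 3) ^ 2 := by
    calc (8 * a ^ 2 * d + b ^ 3 - 4 * a * b * c) ^ 2
        = |8 * a ^ 2 * d + b ^ 3 - 4 * a * b * c| ^ 2 := (sq_abs _).symm
      _ ≤ (13 * (T : ℤ) ^ 3) ^ 2 := pow_le_pow_left₀ (abs_nonneg _) h 2
  have : (((8 * a ^ 2 * d + b ^ 3 - 4 * a * b * c) ^ 2).natAbs : ℤ) ≤ ((169 * T ^ 6 : ℕ) : ℤ) := by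
    rw [Int.natAbs_of_nonneg (sq_nonneg _)]
    push_cast
    nlinarith [hsq]
  exact_mod_cast this

/-! ## §2 The count in the box `[−T, T]⁵` -/

/-- **Forms with a rationally reducible resolvent cubic are negligible in boxes.** For every
`ε > 0` there is `C > 0` such that for all `T ≥ 1` the integer vectors `(a,b,c,d,e) ∈ [−T,T]⁵` with
`a ≠ 0` whose resolvent cubic `g = X³ + cX²Y + (bd − 4ae)XY² + (ad² + b²e − 4ace)Y³` has an integer
root `g(r, 1) = 0` number at most `C·T^{4+ε}` (against `(2T+1)⁵` vectors in the box). Elementary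
(see the module docstring); the only external input is the divisor bound. [folklore] -/
theorem card_box_filter_exists_int_root_resolvent_le {ε : ℝ} (hε : 0 < ε) :
    ∃ C : ℝ, 0 < C ∧ ∀ T : ℕ, 1 ≤ T →
      ((((Fintype.piFinset fun _ : Fin 4 => Icc (-(T : ℤ)) T) ×ˢ Icc (-(T : ℤ)) T).filter
        fun x : (Fin 4 → ℤ) × ℤ => x.1 0 ≠ 0 ∧ ∃ r : ℤ,
          r ^ 3 + x.1 2 * r ^ 2 + (x.1 1 * x.1 3 - 4 * x.1 0 * x.2) * r
            + (x.1 0 * x.1 3 ^ 2 + x.1 1 ^ 2 * x.2 - 4 * x.1 0 * x.1 2 * x.2) = 0).card : ℝ)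
        ≤ C * (T : ℝ) ^ (4 + ε) := by
  obtain ⟨Cτ, hCτ1, hCτ⟩ :=
    Literature.NumberTheory.Sieve.exists_card_divisors_le_mul_rpow' (ε := ε / 6) (by positivity)
  refine ⟨81 * (3 + 2 * Cτ * (169 : ℝ) ^ (ε / 6)), by positivity, fun T hT ↦ ?_⟩
  set I : Finset ℤ := Icc (-(T : ℤ)) T with hIdef
  set Box4 : Finset (Fin 4 → ℤ) := Fintype.piFinset fun _ : Fin 4 => I with hBox4def
  have hI : I.card = 2 * T + 1 := by rw [hIdef, Int.card_Icc]; omega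
  have hBox4 : Box4.card = (2 * T + 1) ^ 4 := by
    rw [hBox4def, Fintype.card_piFinset, prod_const, hI, card_univ, Fintype.card_fin]
  have hI3 : ((I ×ˢ I ×ˢ I) ×ˢ I).card = (2 * T + 1) ^ 4 := by
    rw [card_product, card_product, card_product, hI]; ring
  have memI : ∀ {x : ℤ}, x ∈ I ↔ |x| ≤ T := fun {x} ↦ by rw [hIdef]; exact mem_Icc_neg_iff
  -- the polynomial data
  let NN : (Fin 4 → ℤ) → ℤ → ℤ := fun y r ↦ r ^ 3 + y 2 * r ^ 2 + y 1 * y 3 * r + y 0 * y 3 ^ 2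
  let mm : (Fin 4 → ℤ) → ℤ → ℤ := fun y r ↦ y 1 ^ 2 - 4 * y 0 * (r + y 2)
  let Rb : (Fin 4 → ℤ) → ℤ := fun y ↦ 8 * y 0 ^ 2 * y 3 + y 1 ^ 3 - 4 * y 0 * y 1 * y 2
  let root : (Fin 4 → ℤ) → ℤ → ℤ → Prop := fun y e r ↦
    r ^ 3 + y 2 * r ^ 2 + (y 1 * y 3 - 4 * y 0 * e) * r
      + (y 0 * y 3 ^ 2 + y 1 ^ 2 * e - 4 * y 0 * y 2 * e) = 0
  have hroot : ∀ y e r, root y e r ↔ NN y r + e * mm y r = 0 := by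
    intro y e r
    simp only [root, NN, mm]
    rw [resolvent_root_eq]
  -- the three strata
  set S1 : Finset ((Fin 4 → ℤ) × ℤ) := (Box4 ×ˢ I).filter fun x ↦
    x.1 0 ≠ 0 ∧ ∃ r : ℤ, mm x.1 r = 0 ∧ NN x.1 r = 0 with hS1
  set S2 : Finset ((Fin 4 → ℤ) × ℤ) := (Box4 ×ˢ I).filter fun x ↦
    x.1 0 ≠ 0 ∧ Rb x.1 = 0 with hS2
  set S3 : Finset ((Fin 4 → ℤ) × ℤ) := (Box4 ×ˢ I).filter fun x ↦
    x.1 0 ≠ 0 ∧ Rb x.1 ≠ 0 ∧ ∃ r : ℤ, root x.1 x.2 r ∧ mm x.1 r ≠ 0 with hS3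
  have hsplit : ((Box4 ×ˢ I).filter fun x : (Fin 4 → ℤ) × ℤ => x.1 0 ≠ 0 ∧ ∃ r : ℤ,
        r ^ 3 + x.1 2 * r ^ 2 + (x.1 1 * x.1 3 - 4 * x.1 0 * x.2) * r
          + (x.1 0 * x.1 3 ^ 2 + x.1 1 ^ 2 * x.2 - 4 * x.1 0 * x.1 2 * x.2) = 0)
      ⊆ S1 ∪ S2 ∪ S3 := by
    intro x hx
    rw [mem_filter] at hx
    obtain ⟨hxB, ha, r, hr⟩ := hx
    have hr' : NN x.1 r + x.2 * mm x.1 r = 0 := (hroot x.1 x.2 r).mp hr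
    simp only [mem_union, hS1, hS2, hS3, mem_filter]
    by_cases hm : mm x.1 r = 0
    · refine Or.inl (Or.inl ⟨hxB, ha, r, hm, ?_⟩)
      rw [hm, mul_zero, add_zero] at hr'
      exact hr'
    · by_cases hR : Rb x.1 = 0
      · exact Or.inl (Or.inr ⟨hxB, ha, hR⟩)
      · exact Or.inr ⟨hxB, ha, hR, r, hr, hm⟩
  -- (i) `m(r) = 0`: `r` is determined by `(a,b,c)` and `d` solves a nonzero quadratic
  have h1 : S1.card ≤ 2 * (2 * T + 1) ^ 4 := by
    let φ : (Fin 4 → ℤ) × ℤ → (ℤ × ℤ × ℤ) × ℤ := fun x ↦ ((x.1 0, x.1 1, x.1 2), x.2)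
    have himg : S1.image φ ⊆ (I ×ˢ I ×ˢ I) ×ˢ I := by
      intro z hz
      obtain ⟨x, hx, rfl⟩ := mem_image.mp hz
      have hxB := (mem_filter.mp hx).1
      rw [mem_product] at hxB
      have hy := Fintype.mem_piFinset.mp hxB.1
      simp only [φ, mem_product]
      exact ⟨⟨hy 0, hy 1, hy 2⟩, hxB.2⟩
    have hfib : ∀ z ∈ S1.image φ, (S1.filter fun x ↦ φ x = z).card ≤ 2 := by
      intro z hz
      obtain ⟨x₀, hx₀, rfl⟩ := mem_image.mp hz
      obtain ⟨-, ha₀, r₀, hm₀, -⟩ := mem_filter.mp hx₀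
      -- the quadratic in `d`
      set a := x₀.1 0; set b := x₀.1 1; set c := x₀.1 2
      set p : ℤ[X] := C a * X ^ 2 + C (b * r₀) * X + C (r₀ ^ 3 + c * r₀ ^ 2) with hp
      have hp0 : p ≠ 0 := by
        intro h
        have := Polynomial.natDegree_quadratic (b := b * r₀) (c := r₀ ^ 3 + c * r₀ ^ 2) ha₀
        rw [← hp, h, natDegree_zero] at this
        exact absurd this (by norm_num)
      have hdeg : p.natDegree ≤ 2 := by rw [hp]; exact Polynomial.natDegree_quadratic_le
      -- every element of the fibre has `d ∈ roots p`
      have hmem : ∀ x ∈ S1.filter (fun x ↦ φ x = φ x₀), x.1 3 ∈ p.roots.toFinset := by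
        intro x hx
        obtain ⟨hx1, hφ⟩ := mem_filter.mp hx
        obtain ⟨-, ha, r, hm, hN⟩ := mem_filter.mp hx1
        simp only [φ, Prod.mk.injEq] at hφ
        obtain ⟨⟨h0, h1, h2⟩, -⟩ := hφ
        -- same `r`: `4a(r + c) = b² = 4a(r₀ + c)`
        have hr : r = r₀ := by
          have e1 : mm x.1 r = 0 := hm
          have e2 : mm x₀.1 r₀ = 0 := hm₀
          simp only [mm] at e1 e2
          rw [h0, h1, h2] at e1
          have : 4 * a * (r + c) = 4 * a * (r₀ + c) := by
            change 4 * x₀.1 0 * (r + x₀.1 2) = 4 * x₀.1 0 * (r₀ + x₀.1 2); linarith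
          have h4a : (4 * a) ≠ 0 := mul_ne_zero (by norm_num) ha₀
          have := mul_left_cancel₀ h4a this
          linarith
        rw [Multiset.mem_toFinset, mem_roots hp0, IsRoot.def, hp]
        simp only [eval_add, eval_mul, eval_C, eval_pow, eval_X]
        have hN' : NN x.1 r = 0 := hN
        simp only [NN] at hN'
        rw [h0, h1, h2, hr] at hN'
        change x₀.1 0 * x.1 3 ^ 2 + x₀.1 1 * r₀ * x.1 3 + (r₀ ^ 3 + x₀.1 2 * r₀ ^ 2) = 0
        linarith
      have hinj : Set.InjOn (fun x : (Fin 4 → ℤ) × ℤ ↦ x.1 3)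
          (S1.filter (fun x ↦ φ x = φ x₀) : Set ((Fin 4 → ℤ) × ℤ)) := by
        intro x hx x' hx' h3
        rw [coe_filter, Set.mem_setOf_eq] at hx hx'
        have hφ : φ x = φ x' := hx.2.trans hx'.2.symm
        simp only [φ, Prod.mk.injEq] at hφ
        obtain ⟨⟨h0, h1, h2⟩, he⟩ := hφ
        refine Prod.ext (funext fun i ↦ ?_) he
        fin_cases i
        · exact h0
        · exact h1
        · exact h2
        · exact h3
      calc (S1.filter fun x ↦ φ x = φ x₀).card
          ≤ p.roots.toFinset.card := card_le_card_of_injOn _ hmem hinj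
        _ ≤ Multiset.card p.roots := Multiset.toFinset_card_le _
        _ ≤ p.natDegree := Polynomial.card_roots' p
        _ ≤ 2 := hdeg
    calc S1.card ≤ 2 * (S1.image φ).card := card_le_mul_card_image S1 2 hfib
      _ ≤ 2 * ((I ×ˢ I ×ˢ I) ×ˢ I).card := Nat.mul_le_mul_left 2 (card_le_card himg)
      _ = 2 * (2 * T + 1) ^ 4 := by rw [hI3]
  -- (ii) `R = 0`: `d` is determined by `(a,b,c)`
  have h2 : S2.card ≤ (2 * T + 1) ^ 4 := by
    let φ : (Fin 4 → ℤ) × ℤ → (ℤ × ℤ × ℤ) × ℤ := fun x ↦ ((x.1 0, x.1 1, x.1 2), x.2)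
    rw [← hI3]
    refine card_le_card_of_injOn φ (fun x hx ↦ ?_) (fun x hx x' hx' h ↦ ?_)
    · have hxB := (mem_filter.mp hx).1
      rw [mem_product] at hxB
      have hy := Fintype.mem_piFinset.mp hxB.1
      simp only [φ, coe_product, Set.mem_prod, mem_coe]
      exact ⟨⟨hy 0, hy 1, hy 2⟩, hxB.2⟩
    · rw [coe_filter, Set.mem_setOf_eq] at hx hx'
      obtain ⟨-, ha, hR⟩ := hx
      obtain ⟨-, -, hR'⟩ := hx'
      simp only [φ, Prod.mk.injEq] at h
      obtain ⟨⟨h0, h1, h2⟩, he⟩ := h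
      have h3 : x.1 3 = x'.1 3 := by
        have e1 : Rb x.1 = 0 := hR
        have e2 : Rb x'.1 = 0 := hR'
        simp only [Rb] at e1 e2
        rw [h0, h1, h2] at e1
        have ha' : x'.1 0 ≠ 0 := h0 ▸ ha
        have h8 : (8 * x'.1 0 ^ 2) ≠ 0 := mul_ne_zero (by norm_num) (pow_ne_zero 2 ha')
        have : 8 * x'.1 0 ^ 2 * x.1 3 = 8 * x'.1 0 ^ 2 * x'.1 3 := by linarith
        exact mul_left_cancel₀ h8 this
      refine Prod.ext (funext fun i ↦ ?_) he
      fin_cases i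
      · exact h0
      · exact h1
      · exact h2
      · exact h3
  -- (iii) `R ≠ 0`, `m(r) ≠ 0`: `r ↦ |m(r)|` is at most two-to-one into the divisors of `R`
  have h3 : (S3.card : ℝ) ≤ 2 * Cτ * ((169 : ℝ) * (T : ℝ) ^ 6) ^ (ε / 6) * (2 * T + 1) ^ 4 := by
    -- fibrewise over `y = (a,b,c,d)`
    have hfib : ∀ y ∈ Box4, ((I.filter fun e ↦ y 0 ≠ 0 ∧ Rb y ≠ 0 ∧
        ∃ r : ℤ, root y e r ∧ mm y r ≠ 0).card : ℝ) ≤ 2 * Cτ * ((169 : ℝ) * (T : ℝ) ^ 6) ^ (ε / 6) := by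
      intro y hy
      have hyI : ∀ i, |y i| ≤ T := fun i ↦ memI.mp (Fintype.mem_piFinset.mp hy i)
      set E : Finset ℤ := I.filter fun e ↦ y 0 ≠ 0 ∧ Rb y ≠ 0 ∧
        ∃ r : ℤ, root y e r ∧ mm y r ≠ 0 with hE
      by_cases hyR : y 0 ≠ 0 ∧ Rb y ≠ 0
      swap
      · have : E = ∅ := filter_eq_empty_iff.mpr fun e _ h ↦ hyR ⟨h.1, h.2.1⟩
        rw [this, card_empty, Nat.cast_zero]
        positivity
      obtain ⟨ha, hR⟩ := hyR
      -- the chosen root and its `m`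
      let mOf : ℤ → ℤ := fun e ↦
        if h : ∃ r : ℤ, root y e r ∧ mm y r ≠ 0 then mm y h.choose else 0
      have hmOf : ∀ e ∈ E, ∃ r : ℤ, root y e r ∧ mm y r ≠ 0 ∧ mOf e = mm y r := by
        intro e he
        obtain ⟨-, -, -, h⟩ := mem_filter.mp he
        refine ⟨h.choose, h.choose_spec.1, h.choose_spec.2, ?_⟩
        simp only [mOf, dif_pos h]
      -- `mOf e ∣ R`, so `|mOf e|` is a divisor of `R ≠ 0`
      have hdiv : ∀ e ∈ E, (mOf e).natAbs ∈ ((Rb y) ^ 2).natAbs.divisors := by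
        intro e he
        obtain ⟨r, hr, hm, hme⟩ := hmOf e he
        rw [Nat.mem_divisors]
        refine ⟨Int.natAbs_dvd_natAbs.mpr ?_, Int.natAbs_ne_zero.mpr (pow_ne_zero 2 hR)⟩
        rw [hme]
        exact m_dvd_R_of_root ((hroot y e r).mp hr)
      -- `e ↦ mOf e` is injective on `E`
      have hinj_m : ∀ e ∈ E, ∀ e' ∈ E, mOf e = mOf e' → e = e' := by
        intro e he e' he' h
        obtain ⟨r, hr, hm, hme⟩ := hmOf e he
        obtain ⟨r', hr', hm', hme'⟩ := hmOf e' he'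
        rw [hme, hme'] at h
        have hrr : r = r' := by
          simp only [mm] at h
          have h4a : (4 * y 0) ≠ 0 := mul_ne_zero (by norm_num) ha
          have : 4 * y 0 * (r + y 2) = 4 * y 0 * (r' + y 2) := by linarith
          have := mul_left_cancel₀ h4a this
          linarith
        subst hrr
        have e1 := (hroot y e r).mp hr
        have e2 := (hroot y e' r).mp hr'
        have : e * mm y r = e' * mm y r := by linarith
        exact mul_right_cancel₀ hm this
      -- fibres of `e ↦ |mOf e|` have at most two elements (`m` and `−m`)
      have hfib2 : ∀ n ∈ E.image (fun e ↦ (mOf e).natAbs),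
          (E.filter fun e ↦ (mOf e).natAbs = n).card ≤ 2 := by
        intro n _
        have hsub : ∀ e ∈ E.filter (fun e ↦ (mOf e).natAbs = n), mOf e ∈ ({(n : ℤ), -(n : ℤ)} : Finset ℤ) := by
          intro e he
          obtain ⟨-, hn⟩ := mem_filter.mp he
          rw [mem_insert, mem_singleton]
          rcases Int.natAbs_eq (mOf e) with h | h
          · exact Or.inl (by rw [h, hn])
          · exact Or.inr (by rw [h, hn])
        have hinj : Set.InjOn mOf (E.filter (fun e ↦ (mOf e).natAbs = n) : Set ℤ) := by
          intro e he e' he' h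
          rw [coe_filter, Set.mem_setOf_eq] at he he'
          exact hinj_m e he.1 e' he'.1 h
        calc (E.filter fun e ↦ (mOf e).natAbs = n).card
            ≤ ({(n : ℤ), -(n : ℤ)} : Finset ℤ).card := card_le_card_of_injOn mOf hsub hinj
          _ ≤ 2 := card_insert_le _ _ |>.trans (by simp)
      have hEcard : E.card ≤ 2 * ((Rb y) ^ 2).natAbs.divisors.card := by
        calc E.card ≤ 2 * (E.image fun e ↦ (mOf e).natAbs).card :=
              card_le_mul_card_image E 2 hfib2
          _ ≤ 2 * ((Rb y) ^ 2).natAbs.divisors.card := by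
              refine Nat.mul_le_mul_left 2 (card_le_card fun n hn ↦ ?_)
              obtain ⟨e, he, rfl⟩ := mem_image.mp hn
              exact hdiv e he
      -- the divisor bound
      have hRle : (((Rb y) ^ 2).natAbs : ℝ) ≤ 169 * (T : ℝ) ^ 6 := by
        have := natAbs_R_le (hyI 0) (hyI 1) (hyI 2) (hyI 3)
        exact_mod_cast this
      calc (E.card : ℝ) ≤ 2 * (((Rb y) ^ 2).natAbs.divisors.card : ℝ) := by exact_mod_cast hEcard
        _ ≤ 2 * (Cτ * ((((Rb y) ^ 2).natAbs : ℕ) : ℝ) ^ (ε / 6)) := by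
            gcongr; exact hCτ _
        _ ≤ 2 * (Cτ * ((169 : ℝ) * (T : ℝ) ^ 6) ^ (ε / 6)) := by
            gcongr
        _ = 2 * Cτ * ((169 : ℝ) * (T : ℝ) ^ 6) ^ (ε / 6) := by ring
    calc (S3.card : ℝ) = ∑ y ∈ Box4, ((I.filter fun e ↦ y 0 ≠ 0 ∧ Rb y ≠ 0 ∧
          ∃ r : ℤ, root y e r ∧ mm y r ≠ 0).card : ℝ) := by
          rw [hS3, card_filter, sum_product]
          push_cast
          exact sum_congr rfl fun y _ ↦ by rw [card_filter]; push_cast; rfl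
      _ ≤ ∑ y ∈ Box4, 2 * Cτ * ((169 : ℝ) * (T : ℝ) ^ 6) ^ (ε / 6) := sum_le_sum hfib
      _ = 2 * Cτ * ((169 : ℝ) * (T : ℝ) ^ 6) ^ (ε / 6) * (2 * T + 1) ^ 4 := by
          rw [sum_const, nsmul_eq_mul, hBox4]; push_cast; ring
  -- assembly
  have hT1 : (1 : ℝ) ≤ T := by exact_mod_cast hT
  have hTpos : (0 : ℝ) < T := by linarith
  have hpow : ((169 : ℝ) * (T : ℝ) ^ 6) ^ (ε / 6) = (169 : ℝ) ^ (ε / 6) * (T : ℝ) ^ ε := by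
    rw [Real.mul_rpow (by norm_num) (by positivity)]
    congr 1
    rw [← Real.rpow_natCast, ← Real.rpow_mul hTpos.le]
    congr 1
    push_cast
    ring
  have hTε : (1 : ℝ) ≤ (T : ℝ) ^ ε := Real.one_le_rpow hT1 hε.le
  have h2T1 : ((2 * T + 1 : ℕ) : ℝ) ^ 4 ≤ 81 * (T : ℝ) ^ 4 := by
    have : ((2 * T + 1 : ℕ) : ℝ) ≤ 3 * T := by push_cast; linarith
    calc ((2 * T + 1 : ℕ) : ℝ) ^ 4 ≤ (3 * (T : ℝ)) ^ 4 := by gcongr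
      _ = 81 * (T : ℝ) ^ 4 := by ring
  have hsplitR : ((((Box4 ×ˢ I).filter fun x : (Fin 4 → ℤ) × ℤ => x.1 0 ≠ 0 ∧ ∃ r : ℤ,
        r ^ 3 + x.1 2 * r ^ 2 + (x.1 1 * x.1 3 - 4 * x.1 0 * x.2) * r
          + (x.1 0 * x.1 3 ^ 2 + x.1 1 ^ 2 * x.2 - 4 * x.1 0 * x.1 2 * x.2) = 0).card : ℕ) : ℝ)
      ≤ (S1.card : ℝ) + S2.card + S3.card := by
    have := (card_le_card hsplit).trans ((card_union_le _ _).trans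
      (Nat.add_le_add_right (card_union_le _ _) _))
    exact_mod_cast this
  have h4ε : (T : ℝ) ^ (4 + ε) = (T : ℝ) ^ 4 * (T : ℝ) ^ ε := by
    rw [Real.rpow_add hTpos, Real.rpow_ofNat]
  calc _ ≤ (S1.card : ℝ) + S2.card + S3.card := hsplitR
    _ ≤ 2 * ((2 * T + 1 : ℕ) : ℝ) ^ 4 + ((2 * T + 1 : ℕ) : ℝ) ^ 4
        + 2 * Cτ * ((169 : ℝ) ^ (ε / 6) * (T : ℝ) ^ ε) * ((2 * T + 1 : ℕ) : ℝ) ^ 4 := by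
        rw [← hpow]
        have e1 : (S1.card : ℝ) ≤ 2 * ((2 * T + 1 : ℕ) : ℝ) ^ 4 := by exact_mod_cast h1
        have e2 : (S2.card : ℝ) ≤ ((2 * T + 1 : ℕ) : ℝ) ^ 4 := by exact_mod_cast h2
        have e3 : (S3.card : ℝ) ≤ 2 * Cτ * ((169 : ℝ) * (T : ℝ) ^ 6) ^ (ε / 6) * ((2 * T + 1 : ℕ) : ℝ) ^ 4 := by
          convert h3 using 2; push_cast; ring
        linarith
    _ = (3 + 2 * Cτ * (169 : ℝ) ^ (ε / 6) * (T : ℝ) ^ ε) * ((2 * T + 1 : ℕ) : ℝ) ^ 4 := by ring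
    _ ≤ (3 * (T : ℝ) ^ ε + 2 * Cτ * (169 : ℝ) ^ (ε / 6) * (T : ℝ) ^ ε) * (81 * (T : ℝ) ^ 4) := by
        gcongr
        · linarith
    _ = 81 * (3 + 2 * Cτ * (169 : ℝ) ^ (ε / 6)) * (T : ℝ) ^ (4 + ε) := by rw [h4ε]; ring

/-- **The same for any finite set of forms with coefficients bounded by `T`** (e.g. the lattice
points of `𝓕^{(ε)}·R^{(i)}(X)`, `T ≍ X^{1/6}`): the forms `f ∈ B` with `a ≠ 0` whose resolvent
cubic `g_f(X, 1)` has an integer root number at most `C·T^{4+ε}`. [folklore] -/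
theorem card_filter_exists_int_root_resolvent_le {ε : ℝ} (hε : 0 < ε) :
    ∃ C : ℝ, 0 < C ∧ ∀ T : ℕ, 1 ≤ T → ∀ B : Finset (BinaryQuartic ℤ),
      (∀ f ∈ B, |f.a| ≤ T ∧ |f.b| ≤ T ∧ |f.c| ≤ T ∧ |f.d| ≤ T ∧ |f.e| ≤ T) →
      ((B.filter fun f => f.a ≠ 0 ∧ ∃ r : ℤ,
          r ^ 3 + f.c * r ^ 2 + (f.b * f.d - 4 * f.a * f.e) * r
            + (f.a * f.d ^ 2 + f.b ^ 2 * f.e - 4 * f.a * f.c * f.e) = 0).card : ℝ)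
        ≤ C * (T : ℝ) ^ (4 + ε) := by
  obtain ⟨C, hC, h⟩ := card_box_filter_exists_int_root_resolvent_le hε
  refine ⟨C, hC, fun T hT B hB ↦ le_trans ?_ (h T hT)⟩
  gcongr
  refine card_le_card_of_injOn (fun f => (![f.a, f.b, f.c, f.d], f.e)) (fun f hf => ?_)
    (fun f _ g _ hfg => ?_)
  · rw [mem_coe, mem_filter] at hf
    obtain ⟨hfB, ha, r, hr⟩ := hf
    obtain ⟨h0, h1, h2, h3, h4⟩ := hB f hfB
    simp only [coe_filter, Set.mem_setOf_eq, mem_product, Fintype.mem_piFinset, mem_Icc_neg_iff]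
    refine ⟨⟨fun i => ?_, h4⟩, ?_, r, ?_⟩
    · fin_cases i
      · exact h0
      · exact h1
      · exact h2
      · exact h3
    · simpa using ha
    · simpa using hr
  · simp only [Prod.mk.injEq] at hfg
    obtain ⟨h, he⟩ := hfg
    have h0 := congr_fun h 0
    have h1 := congr_fun h 1
    have h2 := congr_fun h 2
    have h3 := congr_fun h 3
    simp only [Matrix.cons_val_zero, Matrix.cons_val_one, Matrix.cons_val] at h0 h1 h2 h3
    exact BinaryQuartic.ext h0 h1 (by simpa using h2) (by simpa using h3) he

/-! ## §3 Integer roots of `g_f(X, 1)` and reducibility over `ℚ` -/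

/-- **`g_f(X, 1)` has an integer root iff it is reducible over `ℚ`** (the resolvent cubic is
monic: a rational root is an integer by the rational root theorem, and a cubic over a field is
reducible iff it has a root). So the forms counted above are exactly those with `a ≠ 0` whose
resolvent cubic form is reducible over `ℚ` — the failure of the second condition in the definition
of absolutely irreducible pairs of [dodqf, §2.2 p. 1037] for `φ(f)`. [folklore] -/
theorem exists_int_root_resolvent_iff_not_irreducible (f : BinaryQuartic ℤ) :
    (∃ r : ℤ, r ^ 3 + f.c * r ^ 2 + (f.b * f.d - 4 * f.a * f.e) * r
        + (f.a * f.d ^ 2 + f.b ^ 2 * f.e - 4 * f.a * f.c * f.e) = 0)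
      ↔ ¬ Irreducible ((resolventCubic f).toPoly.map (Int.castRingHom ℚ)) := by
  set P : ℤ[X] := (resolventCubic f).toPoly with hP
  set Q : ℚ[X] := P.map (Int.castRingHom ℚ) with hQ
  have hPm : P.Monic := Cubic.monic_of_a_eq_one rfl
  have hQeq : Q = (Cubic.map (Int.castRingHom ℚ) (resolventCubic f)).toPoly := by
    rw [hQ, hP, Cubic.map_toPoly]
  have hQdeg : Q.natDegree = 3 := by
    rw [hQeq]
    exact Cubic.natDegree_of_a_ne_zero (by simp [Cubic.map, resolventCubic])
  have hQ0 : Q ≠ 0 := by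
    intro h; rw [h, natDegree_zero] at hQdeg; exact absurd hQdeg (by norm_num)
  have heval : ∀ q : ℚ, Q.eval q = q ^ 3 + f.c * q ^ 2 + (f.b * f.d - 4 * f.a * f.e) * q
      + (f.a * f.d ^ 2 + f.b ^ 2 * f.e - 4 * f.a * f.c * f.e) := by
    intro q
    rw [hQeq]
    simp only [Cubic.toPoly, Cubic.map, resolventCubic, eq_intCast, map_one,
      eval_add, eval_mul, eval_C, eval_pow, eval_X, one_mul]
    push_cast
    ring
  rw [Polynomial.irreducible_iff_roots_eq_zero_of_degree_le_three (by omega) (by omega)]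
  constructor
  · rintro ⟨r, hr⟩ hroots
    have : (r : ℚ) ∈ Q.roots := by
      rw [mem_roots hQ0, IsRoot.def, heval]
      exact_mod_cast hr
    rw [hroots] at this
    exact Multiset.notMem_zero _ this
  · intro hroots
    obtain ⟨q, hq⟩ := Multiset.exists_mem_of_ne_zero hroots
    rw [mem_roots hQ0, IsRoot.def] at hq
    -- `q` is an integer (rational root theorem for the monic `P`)
    have haeval : aeval q P = 0 := by
      rw [aeval_def, ← Polynomial.eval_map, algebraMap_int_eq, ← hQ]
      exact hq
    obtain ⟨r, hr, -⟩ := exists_integer_of_is_root_of_monic hPm haeval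
    refine ⟨r, ?_⟩
    rw [hr, heval] at hq
    simp only [algebraMap_int_eq, eq_intCast] at hq
    exact_mod_cast hq

end BinaryQuartic

end Literature.NumberTheory.EllipticCurves

end
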